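import Literature.NumberTheory.PAdicHodge.PadicBaseField
import Literature.IUT.LogVolume.UnitLogNormTrace
import Literature.IUT.LogVolume.LogRadius
import Mathlib.Analysis.Normed.Unbundled.SpectralNorm
import Mathlib.Analysis.SpecialFunctions.Pow.Real
import HarnessLib

/-!
# A `p`-adic field (valuation side) as a normed `ℚ_p`-algebra: the `ℚ_p`-normalised absolute value,
# and `log_p ∘ N_{F/ℚ_p} = Tr_{F/ℚ_p} ∘ log_p` in the tree's local-field currency

Topic `NumberTheory/PAdicHodge`; namespace `Literature.NumberTheory.PAdicHodge.PadicField`. The tree describes a `p`-adic field in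
TWO currencies: VALUATION side (`[IsNonarchimedeanLocalField F] [CharZero F]`, `hp : valuation F p < 1`, canonical `ℚ_p`-structure
`LocalField.padicAlgebra F p hp` — the currency of `GaloisRepresentations/*`, `PAdicHodge/*`, of `v.adicCompletion K` and of Kato's
reciprocity law `EllipticCurves.tatePairingPoint_eq_trace_expStar_log`, whose right-hand side is `Algebra.trace ℚ_[p] F (…)`), and NORM side
(`[NormedAlgebra ℚ_[p] K] [IsUltrametricDist K] [ProperSpace K]` — the currency of the abc-iut cell's `IUT/LogVolume/*`: the `p`-adic logarithm
`unitLog = log_p : 𝒪_Kˣ → K`, `log_p(N_{k'/k} u) = Tr_{k'/k}(log_p u)` (`unitLog_norm_eq_trace_unitLog`), `p^a 𝒪 ⊆ log_p(𝒪ˣ)` (`LogRadius`)).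
The only normed structure the tree puts on a valuation-side `F` is `IsNonarchimedeanLocalField.nontriviallyNormedField F` (an unspecified
rank-one embedding of the value group), whose restriction to `ℚ_p` is `|·|_p ^ s` for some `s > 0` — NOT a normed `ℚ_p`-algebra
(`CompletedAlgClosurePadicComplex` §1 records this for `F = ℚ_p`). This file supplies the bridge:

* §1 `PadicField.normedField F p hp : NontriviallyNormedField F` — the **`ℚ_p`-NORMALISED absolute value** `‖x‖ = |N_{F/ℚ_p} x|_p^{1/[F:ℚ_p]}`
  (Mathlib's spectral norm `spectralNorm ℚ_[p] F` for `LocalField.padicAlgebra`; `F/ℚ_p` is finite, `PadicBase.instFiniteDimensional`), with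
  `PadicField.normedAlgebra : NormedAlgebra ℚ_[p] F`, `norm_algebraMap` (`‖ι x‖ = |x|_p`), `isUltrametricDist`, `completeSpace`, `properSpace`
  — exactly the instance package of `IUT/LogVolume`. `def`s, installed with `letI` (never instances: they are keyed on `hp`).
* §2 ★ `exists_rpow_spectralNorm_eq_norm` — **the valuation norm is a power of it**: `‖x‖_val = ‖x‖ ^ s` for ONE `s > 0` and all `x ∈ F`
  (on `ℚ_p`: `‖ι x‖_val = ‖p‖_val^{v_p x}` (`PadicBase.norm_eq_norm_p_zpow`) `= |x|_p^s`; then `‖·‖_val^{1/s}` is an absolute value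
  extending `|·|_p`, hence the spectral norm, Mathlib `spectralNorm_unique_field_norm_ext`). Consequences: ★ `norm_le_one_iff` (`‖x‖ ≤ 1 ↔
  x ∈ 𝒪[F]`), `norm_lt_one_iff` / `norm_eq_one_iff` (`↔ valuation F x < 1` / `= 1`), and `uniformSpace_eq` / `topologicalSpace_eq`: the
  spectral-norm uniformity and topology ARE the given ones of `F`.
* §3 ★★ `unitLog_norm_eq_trace_unitLog` — **`log_p(N_{F/ℚ_p} u) = Tr_{F/ℚ_p}(log_p u)` for every `u ∈ 𝒪[F]ˣ` (`valuation F u = 1`)** in the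
  valuation-side currency (`N`, `Tr` for `LocalField.padicAlgebra`; `log_p` on `ℚ_p` is `IUT.LogVolume.unitLog`, on `F` it is `unitLog` for
  `PadicField.normedField`), `unitLog_algebraMap` (`log_p` commutes with `ι : ℚ_p → F`), `norm_unitLog_le` and ★ `span_logUnits_eq_top`
  (`ℚ_p · log_p(𝒪[F]ˣ) = F`, from `p^a 𝒪 ⊆ log_p(𝒪ˣ)`).

Use (line `kato_lever` of crux K★ `stmt-BirchSwinnertonDyer-22226`, floor (H5) of Kato II §1.4): with `LogCyclotomicCupProductNorm`
(`inv_∞(κ_∞(u) ∪ log χ_cyclo) = −log_p N_{K_v/ℚ_p}(u)`) this gives Kato's Lemma 1.4.5 in its printed form `= −Tr_{K_v/ℚ_p}(log_p u)`, and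
`span_logUnits_eq_top` is the input of its `F`-linear extension (`F = ℚ_p · log 𝒪_Fˣ`). Infrastructure only; BSD / K★ / [REC] are NOT proved
by any of this.

## References
* J. Neukirch, *Algebraic Number Theory* (1999), Ch. II (3.3) (equivalent absolute values are powers of each other), (4.8) (uniqueness of the
  extension, `|x| = |N x|^{1/n}`), (5.2) (`p`-adic fields are finite over `ℚ_p`), (5.5) (`log_p`). [NeukirchANT1999]
* S. Bosch, U. Güntzer, R. Remmert, *Non-Archimedean Analysis* (1984), §3.2 (spectral norm), as formalised in Mathlib.
* J.-P. Serre, *Local Fields* (1979), Ch. II §2 Cor. 2, §5. [SerreLocalFields1979]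
-/

noncomputable section

open ValuativeRel Field Filter Topology

namespace Literature.NumberTheory.PAdicHodge

open Literature.NumberTheory.GaloisRepresentations
open Literature.NumberTheory.GaloisRepresentations.IsNonarchimedeanLocalField
open Literature.IUT.LogVolume

namespace PadicField

variable (F : Type) [Field F] [ValuativeRel F] [TopologicalSpace F] [IsNonarchimedeanLocalField F] [CharZero F]
  (p : ℕ) [hprime : Fact p.Prime] (hp : valuation F p < 1)

/-! ## §1 The `ℚ_p`-normalised absolute value and its instance package -/

/-- `F/ℚ_p` is algebraic for the canonical `ℚ_p`-structure (it is finite: `PadicBase.instFiniteDimensional`, read on `ℚ_[p]` itself —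
`PadicBase F p hp` is a synonym of `ℚ_[p]` with the same algebra map). [cite: NeukirchANT1999, Ch. II (5.2)] -/
theorem isAlgebraic : letI := LocalField.padicAlgebra F p hp; Algebra.IsAlgebraic ℚ_[p] F :=
  PadicBase.instIsAlgebraic (F := F) (p := p) hp

/-- `F/ℚ_p` is finite-dimensional for the canonical `ℚ_p`-structure. [cite: NeukirchANT1999, Ch. II (5.2)] -/
theorem finiteDimensional : letI := LocalField.padicAlgebra F p hp; FiniteDimensional ℚ_[p] F :=
  PadicBase.instFiniteDimensional (F := F) (p := p) hp

/-- **The `ℚ_p`-normalised absolute value of the `p`-adic field `F`**: `F` as a nontrivially normed field for the spectral norm of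
`F/ℚ_p` (`‖x‖ = |N_{ℚ_p(x)/ℚ_p}(x)|_p^{1/[ℚ_p(x):ℚ_p]}`, the unique absolute value extending `|·|_p`), relative to the canonical
`ℚ_p`-structure `LocalField.padicAlgebra F p hp`. A `def` (install with `letI`). [cite: NeukirchANT1999, Ch. II (4.8)] -/
@[implicit_reducible]
def normedField : NontriviallyNormedField F :=
  letI := LocalField.padicAlgebra F p hp
  haveI := isAlgebraic F p hp
  spectralNorm.nontriviallyNormedField ℚ_[p] F

/-- The norm of `PadicField.normedField` is the spectral norm over `ℚ_p`. [cite: NeukirchANT1999, Ch. II (4.8)] -/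
theorem norm_def (x : F) :
    @Norm.norm F (normedField F p hp).toNorm x = (letI := LocalField.padicAlgebra F p hp; spectralNorm ℚ_[p] F x) :=
  rfl

/-- **`F` is a normed `ℚ_p`-algebra** for `PadicField.normedField` and `LocalField.padicAlgebra` (Mathlib `spectralNorm.normedAlgebra`).
A `def` (install with `letI`, after `normedField`). [cite: NeukirchANT1999, Ch. II (4.8)] -/
@[implicit_reducible]
def normedAlgebra : letI := normedField F p hp; NormedAlgebra ℚ_[p] F :=
  letI := LocalField.padicAlgebra F p hp
  haveI := isAlgebraic F p hp
  spectralNorm.normedAlgebra ℚ_[p] F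

/-- The algebra underlying `PadicField.normedAlgebra` IS `LocalField.padicAlgebra` (so `Algebra.norm ℚ_[p]`, `Algebra.trace ℚ_[p] F`
read through either structure coincide). [cite: NeukirchANT1999, Ch. II (4.8)] -/
theorem normedAlgebra_toAlgebra :
    (letI := normedField F p hp; (normedAlgebra F p hp).toAlgebra) = LocalField.padicAlgebra F p hp :=
  rfl

/-- `‖ι x‖ = |x|_p`: the absolute value extends the `p`-adic one along `ι = algebraMap ℚ_[p] F` (Mathlib `spectralNorm_extends`).
[cite: NeukirchANT1999, Ch. II (4.8)] -/
theorem norm_algebraMap (x : ℚ_[p]) :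
    letI := normedField F p hp; letI := LocalField.padicAlgebra F p hp
    ‖algebraMap ℚ_[p] F x‖ = ‖x‖ := by
  letI := LocalField.padicAlgebra F p hp
  haveI := isAlgebraic F p hp
  exact spectralNorm_extends x

/-- `‖(p : F)‖ = p⁻¹`. [cite: NeukirchANT1999, Ch. II (4.8)] -/
theorem norm_natCast_p : letI := normedField F p hp; ‖(p : F)‖ = (p : ℝ)⁻¹ := by
  letI := LocalField.padicAlgebra F p hp
  have h := norm_algebraMap F p hp (p : ℚ_[p])
  rw [map_natCast, Padic.norm_p] at h
  exact h

/-- The absolute value is ultrametric (Mathlib `isNonarchimedean_spectralNorm`). [cite: NeukirchANT1999, Ch. II (4.8)] -/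
theorem isUltrametricDist :
    @IsUltrametricDist F (normedField F p hp).toNormedField.toMetricSpace.toPseudoMetricSpace.toDist := by
  letI := LocalField.padicAlgebra F p hp
  haveI := isAlgebraic F p hp
  letI := normedField F p hp
  exact IsUltrametricDist.isUltrametricDist_of_isNonarchimedean_norm isNonarchimedean_spectralNorm

/-- `F` is complete for the `ℚ_p`-normalised absolute value (finite-dimensional over the complete field `ℚ_p`).
[cite: NeukirchANT1999, Ch. II (4.8)] -/
theorem completeSpace : @CompleteSpace F (normedField F p hp).toUniformSpace := by
  letI := LocalField.padicAlgebra F p hp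
  haveI := isAlgebraic F p hp
  haveI := finiteDimensional F p hp
  exact spectralNorm.completeSpace ℚ_[p] F

/-- `F` is a proper metric space for the `ℚ_p`-normalised absolute value (finite-dimensional over the locally compact field `ℚ_p`,
Mathlib `FiniteDimensional.proper`). [cite: NeukirchANT1999, Ch. II (5.2)] -/
theorem properSpace : @ProperSpace F (normedField F p hp).toNormedField.toMetricSpace.toPseudoMetricSpace := by
  letI := LocalField.padicAlgebra F p hp
  haveI := finiteDimensional F p hp
  letI := normedField F p hp
  letI := normedAlgebra F p hp
  exact FiniteDimensional.proper ℚ_[p] F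

/-! ## §2 Comparison with the valuation norm: `‖·‖_val = ‖·‖ ^ s` -/

/-- On `ℚ_p` the valuation norm of `F` is a POWER of the `p`-adic absolute value: `‖ι x‖_val = |x|_p ^ s` for one `s > 0`
(`‖ι x‖_val = ‖p‖_val^{v_p(x)}`, `PadicBase.norm_eq_norm_p_zpow`, and `0 < ‖p‖_val < 1`). [cite: NeukirchANT1999, Ch. II (3.3)] -/
theorem exists_rpow_padicNorm_eq_norm_algebraMap :
    ∃ s : ℝ, 0 < s ∧ ∀ x : ℚ_[p],
      (letI := nontriviallyNormedField F; letI := LocalField.padicAlgebra F p hp; ‖algebraMap ℚ_[p] F x‖) = ‖x‖ ^ s := by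
  letI := nontriviallyNormedField F
  letI := LocalField.padicAlgebra F p hp
  set c : ℝ := ‖(p : PadicBase F p hp)‖ with hc_def
  have hc0 : 0 < c := PadicBase.norm_p_pos hp
  have hc1 : c < 1 := PadicBase.norm_p_lt_one hp
  have hp0 : (0 : ℝ) < p := by exact_mod_cast hprime.out.pos
  have hp1 : (1 : ℝ) < p := by exact_mod_cast hprime.out.one_lt
  have hlogc : Real.log c < 0 := Real.log_neg hc0 hc1
  have hlogp : Real.log ((p : ℝ)⁻¹) < 0 := Real.log_neg (inv_pos.2 hp0) (inv_lt_one_of_one_lt₀ hp1)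
  set s : ℝ := Real.log c / Real.log ((p : ℝ)⁻¹) with hs_def
  have hs : 0 < s := div_pos_of_neg_of_neg hlogc hlogp
  have hcs : ((p : ℝ)⁻¹) ^ s = c := by
    rw [Real.rpow_def_of_pos (inv_pos.2 hp0), hs_def, mul_div_cancel₀ _ hlogp.ne, Real.exp_log hc0]
  refine ⟨s, hs, fun x => ?_⟩
  by_cases hx : x = 0
  · subst hx
    rw [map_zero, norm_zero, norm_zero, Real.zero_rpow hs.ne']
  · -- `‖ι x‖_val = ‖x'‖_{PadicBase} = c ^ v_p(x)`
    have h1 : ‖algebraMap ℚ_[p] F x‖ = ‖((PadicBase.toPadic hp).symm x : PadicBase F p hp)‖ := rfl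
    have hx' : ((PadicBase.toPadic hp).symm x : PadicBase F p hp) ≠ 0 := fun h =>
      hx (by simpa using congrArg (PadicBase.toPadic hp) h)
    rw [h1, PadicBase.norm_eq_norm_p_zpow hp _ hx', ← hc_def, Padic.norm_eq_zpow_neg_valuation hx]
    change c ^ x.valuation = ((p : ℝ) ^ (-x.valuation)) ^ s
    rw [← hcs, ← Real.rpow_intCast, ← Real.rpow_mul (inv_pos.2 hp0).le, mul_comm, Real.rpow_mul (inv_pos.2 hp0).le,
      Real.rpow_intCast, inv_zpow', ]

/-- ★ **The valuation norm is a power of the `ℚ_p`-normalised one**: for ONE `s > 0`, `‖x‖_val = ‖x‖ ^ s` for all `x ∈ F` —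
`x ↦ ‖x‖_val^{1/s}` is an absolute value on `F` extending `|·|_p` (previous theorem), hence equal to the spectral norm (Mathlib
`spectralNorm_unique_field_norm_ext`: uniqueness of the extension of a complete absolute value). [cite: NeukirchANT1999, Ch. II (3.3), (4.8)] -/
theorem exists_rpow_norm_eq_norm :
    ∃ s : ℝ, 0 < s ∧ ∀ x : F,
      (letI := nontriviallyNormedField F; ‖x‖) = (@Norm.norm F (normedField F p hp).toNorm x) ^ s := by
  letI := nontriviallyNormedField F
  letI := LocalField.padicAlgebra F p hp
  haveI := isAlgebraic F p hp
  obtain ⟨s, hs, hsx⟩ := exists_rpow_padicNorm_eq_norm_algebraMap F p hp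
  -- the absolute value `‖·‖_val ^ (1/s)`
  let f : AbsoluteValue F ℝ :=
    { toFun := fun x => ‖x‖ ^ s⁻¹
      map_mul' := fun x y => by
        simp only [norm_mul]
        exact Real.mul_rpow (norm_nonneg _) (norm_nonneg _)
      nonneg' := fun x => Real.rpow_nonneg (norm_nonneg _) _
      eq_zero' := fun x => by
        change ‖x‖ ^ s⁻¹ = 0 ↔ x = 0
        rw [Real.rpow_eq_zero (norm_nonneg _) (inv_ne_zero hs.ne'), norm_eq_zero]
      add_le' := fun x y => by
        change ‖x + y‖ ^ s⁻¹ ≤ ‖x‖ ^ s⁻¹ + ‖y‖ ^ s⁻¹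
        have hmax : ‖x + y‖ ^ s⁻¹ ≤ (max ‖x‖ ‖y‖) ^ s⁻¹ :=
          Real.rpow_le_rpow (norm_nonneg _) (IsUltrametricDist.norm_add_le_max x y) (inv_pos.2 hs).le
        refine hmax.trans ?_
        rcases le_total ‖x‖ ‖y‖ with h | h
        · rw [max_eq_right h]
          exact le_add_of_nonneg_left (Real.rpow_nonneg (norm_nonneg _) _)
        · rw [max_eq_left h]
          exact le_add_of_nonneg_right (Real.rpow_nonneg (norm_nonneg _) _) }
  have hf : ∀ x : ℚ_[p], f (algebraMap ℚ_[p] F x) = ‖x‖ := fun x => by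
    change ‖algebraMap ℚ_[p] F x‖ ^ s⁻¹ = ‖x‖
    rw [hsx x, Real.rpow_rpow_inv (norm_nonneg _) hs.ne']
  refine ⟨s, hs, fun x => ?_⟩
  have hx : f x = spectralNorm ℚ_[p] F x := spectralNorm_unique_field_norm_ext hf x
  rw [norm_def, ← hx]
  change ‖x‖ = (‖x‖ ^ s⁻¹) ^ s
  rw [Real.rpow_inv_rpow (norm_nonneg _) hs.ne']

/-- ★ **The unit ball is the valuation ring**: `‖x‖ ≤ 1 ↔ x ∈ 𝒪[F]`. [cite: NeukirchANT1999, Ch. II (4.8)] -/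
theorem norm_le_one_iff (x : F) : letI := normedField F p hp; ‖x‖ ≤ 1 ↔ x ∈ 𝒪[F] := by
  obtain ⟨s, hs, hsx⟩ := exists_rpow_norm_eq_norm F p hp
  rw [← IsNonarchimedeanLocalField.norm_le_one_iff F x, hsx x]
  letI := normedField F p hp
  rw [← Real.rpow_le_rpow_iff (norm_nonneg x) zero_le_one hs, Real.one_rpow]

/-- `‖x‖ ≤ 1 ↔ valuation F x ≤ 1`. [cite: NeukirchANT1999, Ch. II (4.8)] -/
theorem norm_le_one_iff_valuation_le_one (x : F) : letI := normedField F p hp; ‖x‖ ≤ 1 ↔ valuation F x ≤ 1 := by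
  rw [norm_le_one_iff]
  exact Valuation.mem_integer_iff _ _

/-- `‖x‖ < 1 ↔ valuation F x < 1` (the open unit ball is the maximal ideal). [cite: NeukirchANT1999, Ch. II (4.8)] -/
theorem norm_lt_one_iff (x : F) : letI := normedField F p hp; ‖x‖ < 1 ↔ valuation F x < 1 := by
  obtain ⟨s, hs, hsx⟩ := exists_rpow_norm_eq_norm F p hp
  rw [← IsNonarchimedeanLocalField.norm_lt_one_iff F x, hsx x]
  letI := normedField F p hp
  rw [← Real.rpow_lt_rpow_iff (norm_nonneg x) zero_le_one hs, Real.one_rpow]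

/-- ★ `‖x‖ = 1 ↔ valuation F x = 1` (the unit sphere is `𝒪[F]ˣ`). [cite: NeukirchANT1999, Ch. II (4.8)] -/
theorem norm_eq_one_iff (x : F) : letI := normedField F p hp; ‖x‖ = 1 ↔ valuation F x = 1 := by
  letI := normedField F p hp
  constructor
  · intro h
    refine le_antisymm ((norm_le_one_iff_valuation_le_one F p hp x).1 h.le) ?_
    by_contra hlt
    exact (((norm_lt_one_iff F p hp x).2 (not_le.1 hlt)).ne h)
  · intro h
    refine le_antisymm ((norm_le_one_iff_valuation_le_one F p hp x).2 h.le) ?_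
    by_contra hlt
    exact ((norm_lt_one_iff F p hp x).1 (not_le.1 hlt)).ne h

/-- The uniformity of the `ℚ_p`-normalised absolute value IS the (additive) uniformity of `F` — the two norms are powers of each
other, so the entourages `{‖x − y‖ < ε}` are cofinal in each other. [cite: NeukirchANT1999, Ch. II (3.3)] -/
theorem uniformSpace_eq : (normedField F p hp).toUniformSpace = (nontriviallyNormedField F).toUniformSpace := by
  obtain ⟨s, hs, hsx⟩ := exists_rpow_norm_eq_norm F p hp
  -- the two distances as functions, and their relation
  have hd₁ : ∀ x y : F, @Dist.dist F (normedField F p hp).toNormedField.toMetricSpace.toPseudoMetricSpace.toDist x y =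
      @Norm.norm F (normedField F p hp).toNorm (x - y) := by
    letI := normedField F p hp; exact fun x y => dist_eq_norm x y
  have hn₁ : ∀ x : F, 0 ≤ @Norm.norm F (normedField F p hp).toNorm x := by
    letI := normedField F p hp; exact fun x => norm_nonneg x
  have hd₂ : ∀ x y : F, @Dist.dist F (nontriviallyNormedField F).toNormedField.toMetricSpace.toPseudoMetricSpace.toDist x y =
      (@Norm.norm F (normedField F p hp).toNorm (x - y)) ^ s := by
    letI := nontriviallyNormedField F; exact fun x y => by rw [dist_eq_norm, hsx]
  refine UniformSpace.ext ?_
  have h₁ := @Metric.uniformity_basis_dist F (normedField F p hp).toNormedField.toMetricSpace.toPseudoMetricSpace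
  have h₂ := @Metric.uniformity_basis_dist F (nontriviallyNormedField F).toNormedField.toMetricSpace.toPseudoMetricSpace
  refine h₁.ext h₂ (fun ε hε => ⟨ε ^ s, Real.rpow_pos_of_pos hε s, fun q hq => ?_⟩)
    (fun ε hε => ⟨ε ^ s⁻¹, Real.rpow_pos_of_pos hε _, fun q hq => ?_⟩)
  · -- `‖q.1 - q.2‖ ^ s < ε ^ s → ‖q.1 - q.2‖ < ε`
    have hq' : @Dist.dist F (nontriviallyNormedField F).toNormedField.toMetricSpace.toPseudoMetricSpace.toDist q.1 q.2 < ε ^ s := hq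
    change @Dist.dist F (normedField F p hp).toNormedField.toMetricSpace.toPseudoMetricSpace.toDist q.1 q.2 < ε
    rw [hd₂] at hq'
    rw [hd₁]
    exact (Real.rpow_lt_rpow_iff (hn₁ _) hε.le hs).1 hq'
  · -- `‖q.1 - q.2‖ < ε ^ (1/s) → ‖q.1 - q.2‖ ^ s < ε`
    have hq' : @Dist.dist F (normedField F p hp).toNormedField.toMetricSpace.toPseudoMetricSpace.toDist q.1 q.2 < ε ^ s⁻¹ := hq
    change @Dist.dist F (nontriviallyNormedField F).toNormedField.toMetricSpace.toPseudoMetricSpace.toDist q.1 q.2 < ε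
    rw [hd₁] at hq'
    rw [hd₂, ← Real.rpow_inv_rpow hε.le hs.ne']
    exact (Real.rpow_lt_rpow_iff (hn₁ _) (Real.rpow_nonneg hε.le _) hs).2 hq'

/-- The topology of the `ℚ_p`-normalised absolute value IS the given topology of `F`. [cite: NeukirchANT1999, Ch. II (3.3)] -/
theorem topologicalSpace_eq : (normedField F p hp).toUniformSpace.toTopologicalSpace = ‹TopologicalSpace F› := by
  rw [uniformSpace_eq]
  rfl

/-! ## §3 `log_p` on `F` and `log_p ∘ N = Tr ∘ log_p` -/

/-- ★★ **`log_p(N_{F/ℚ_p} u) = Tr_{F/ℚ_p}(log_p u)` for every unit `u ∈ 𝒪[F]ˣ`**, valuation-side currency: `N = Algebra.norm ℚ_[p]`,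
`Tr = Algebra.trace ℚ_[p] F` for the canonical `ℚ_p`-structure; `log_p` on `ℚ_p` is `IUT.LogVolume.unitLog`, on `F` it is `unitLog` for
`PadicField.normedField` (the tree's `IUT.LogVolume.unitLog_norm_eq_trace_unitLog`, instances supplied by §1, the unit hypothesis by
`norm_eq_one_iff`). [cite: NeukirchANT1999, Ch. II (4.8), (5.5)] -/
theorem unitLog_norm_eq_trace_unitLog {u : F} (hu : valuation F u = 1) :
    letI := LocalField.padicAlgebra F p hp; letI := normedField F p hp
    unitLog (Algebra.norm ℚ_[p] u) = Algebra.trace ℚ_[p] F (unitLog u) := by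
  letI := normedField F p hp
  letI := normedAlgebra F p hp
  haveI := isUltrametricDist F p hp
  haveI := properSpace F p hp
  exact Literature.IUT.LogVolume.unitLog_norm_eq_trace_unitLog p (k := ℚ_[p]) (k' := F) ((norm_eq_one_iff F p hp u).2 hu)

/-- `‖N_{F/ℚ_p} u‖ = 1` for a unit `u`. [cite: NeukirchANT1999, Ch. II (4.8)] -/
theorem norm_algebraNorm_eq_one {u : F} (hu : valuation F u = 1) :
    letI := LocalField.padicAlgebra F p hp; ‖Algebra.norm ℚ_[p] u‖ = 1 := by
  letI := normedField F p hp
  letI := normedAlgebra F p hp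
  haveI := isUltrametricDist F p hp
  haveI := properSpace F p hp
  exact Literature.IUT.LogVolume.norm_algebraNorm_eq_one p (k := ℚ_[p]) (k' := F) ((norm_eq_one_iff F p hp u).2 hu)

/-- `log_p` commutes with `ι : ℚ_p → F`: `log_p(ι x) = ι(log_p x)` (`ι` is an isometry for the `ℚ_p`-normalised norm; IUT `unitLog_map`).
[cite: NeukirchANT1999, Ch. II (5.5)] -/
theorem unitLog_algebraMap (x : ℚ_[p]) :
    letI := LocalField.padicAlgebra F p hp; letI := normedField F p hp
    unitLog (algebraMap ℚ_[p] F x) = algebraMap ℚ_[p] F (unitLog x) := by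
  letI := LocalField.padicAlgebra F p hp
  letI := normedField F p hp
  letI := normedAlgebra F p hp
  haveI := isUltrametricDist F p hp
  haveI := completeSpace F p hp
  exact unitLog_map p (algebraMap ℚ_[p] F) (norm_algebraMap F p hp) x

/-- ★ **`ℚ_p · log_p(𝒪[F]ˣ) = F`**: the `ℚ_p`-span of `logUnits F = log_p({‖u‖ = 1})` is everything (`p^a · 𝒪 ⊆ log_p(𝒪ˣ)`,
IUT `pBall_logRadiusA_subset_logUnits`; any `x` has `p^N x` in that ball). The input of the `F`-linear extension of Kato's Lemma 1.4.5.
[cite: NeukirchANT1999, Ch. II (5.5)] -/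
theorem span_logUnits_eq_top :
    letI := LocalField.padicAlgebra F p hp; letI := normedField F p hp
    Submodule.span ℚ_[p] (logUnits F) = ⊤ := by
  letI := LocalField.padicAlgebra F p hp
  letI := normedField F p hp
  letI := normedAlgebra F p hp
  haveI := isUltrametricDist F p hp
  haveI := properSpace F p hp
  refine Submodule.eq_top_iff'.2 fun x => ?_
  have hsub := pBall_logRadiusA_subset_logUnits p F
  set a : ℝ := logRadiusA p (absRamificationIdx p F) with ha
  have hp0 : (0 : ℝ) < p := by exact_mod_cast hprime.out.pos
  have hp1 : (1 : ℝ) < p := by exact_mod_cast hprime.out.one_lt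
  -- choose `N` with `p^{-N} ‖x‖ ≤ p^{-a}`
  obtain ⟨N, hN⟩ : ∃ N : ℕ, ‖x‖ * ((p : ℝ)⁻¹) ^ N ≤ (p : ℝ) ^ (-a) := by
    have ht : Tendsto (fun N : ℕ => ‖x‖ * ((p : ℝ)⁻¹) ^ N) atTop (𝓝 (‖x‖ * 0)) :=
      (tendsto_pow_atTop_nhds_zero_of_lt_one (inv_pos.2 hp0).le (inv_lt_one_of_one_lt₀ hp1)).const_mul _
    rw [mul_zero] at ht
    exact (ht.eventually (eventually_le_nhds (Real.rpow_pos_of_pos hp0 _))).exists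
  have hmem : ((p : ℚ_[p]) ^ N) • x ∈ logUnits F := by
    apply hsub
    rw [mem_pBall_iff, norm_smul, norm_pow, Padic.norm_p, mul_comm]
    exact hN
  have hpN : ((p : ℚ_[p]) ^ N) ≠ 0 := pow_ne_zero _ (Nat.cast_ne_zero.2 hprime.out.ne_zero)
  have hx : x = ((p : ℚ_[p]) ^ N)⁻¹ • (((p : ℚ_[p]) ^ N) • x) := by rw [smul_smul, inv_mul_cancel₀ hpN, one_smul]
  rw [hx]
  exact Submodule.smul_mem _ _ (Submodule.subset_span hmem)

end PadicField

end Literature.NumberTheory.PAdicHodge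

end
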